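import Summits.QuantumFields.QCD.Theses.SpectralDefectExtinction
import Literature.MathematicalPhysics.QuantumLattice.OverlapLocality

/-!
# Sketch — crux-ideate round 1, ideator 1, crux `SpectralDefectExtinction.TipPricing`
(stmt-QuantumFields-8967: `TipNoBinding → WegnerEstimate → WindowExtinction`).

First-lemma signatures of three idea cards (they need not be proved here; they must elaborate):

* Card A `hermitian-flow-coarea`: `CoareaPointwise`, `RealModeLanding`, `CoareaTransfer`,
  `ChiralityConverse`.
* Card B `covariant-laplacian-floor`: `RealModePositivity`, `LaplacianFloor`, `LaplacianCount`,
  `PlaquetteDeficitBound`.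
* Card C `tight-from-two-moments`: `TightOfMoments`.
-/

namespace Summit.QuantumFields.QCD.Cruxes.TipPricing.Ideator1

open MeasureTheory
open Literature.MathematicalPhysics.QuantumLattice Literature.MathematicalPhysics.QuantumFieldTheory
  Literature.Probability.LatticeModels
open Summit.QuantumFields.QCD.Theses.SpectralDefectExtinction

noncomputable section

/-! ## Card A — the Hermitian flow `t ↦ Γ₅ (D_W − t)` and the coarea inequality -/

/-- **Coarea inequality, pointwise in the gauge field (ε-form).** For every configuration `U` and
open interval `(t₁, t₂)`: the number of REAL eigenvalues of the massless `r = 1` Wilson–Dirac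
operator in `(t₁, t₂)` (with algebraic multiplicity, as in the route's items) is at most
`liminf_{ε→0} (2ε)⁻¹ ∫_{t₁}^{t₂} #{eigenvalues of Γ₅ D_W(U, −t, 1) in (−ε, ε)} dt` — because the
sorted eigenvalues of the Hermitian family `t ↦ Γ₅(D_W − t)` are `1`-Lipschitz (`‖Γ₅‖ = 1`, Weyl)
and `|det Γ₅(D_W − t)| = |charpoly(D_W)(t)|`. -/
def CoareaPointwise : Prop :=
  ∀ (L : ℕ) [NeZero L] (U : GaugeConfig 4 L ↥(Matrix.specialUnitaryGroup (Fin 3) ℂ)) (t₁ t₂ : ℝ),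
    t₁ < t₂ → ∀ δ : ℝ, 0 < δ → ∃ ε₀ : ℝ, 0 < ε₀ ∧ ∀ ε : ℝ, 0 < ε → ε < ε₀ →
      2 * ε * ((Multiset.countP (fun z : ℂ => z.im = 0 ∧ t₁ < z.re ∧ z.re < t₂)
          (wilsonDirac (fundamentalRep (Fin 3)) U 0 1).charpoly.roots : ℝ) - δ)
        ≤ ∫ t in t₁..t₂, (Multiset.countP (fun z : ℂ => |z.re| < ε)
            (spinorLift gammaFive * wilsonDirac (fundamentalRep (Fin 3)) U (-t) 1).charpoly.roots : ℝ)

/-- **Real-mode landing law** (the spine card's "landing factor `a`" as a statement): the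
Wilson-measure expectation of the number of real eigenvalues of `D_W(U,0,1)` in a sub-interval
`(t₁, t₂) ⊆ [0, 1]` is at most `C (1 + β^p) (t₂ − t₁) L⁴` — linear in the LENGTH of the
interval, extensive, polynomial in `β`. -/
def RealModeLanding : Prop :=
  ∃ C p : ℝ, 0 < C ∧ 0 ≤ p ∧ ∀ β : ℝ, 1 ≤ β → ∀ (L : ℕ) [NeZero L], 2 ≤ L →
    ∀ t₁ t₂ : ℝ, 0 ≤ t₁ → t₁ ≤ t₂ → t₂ ≤ 1 →
      ∫ U, (Multiset.countP (fun z : ℂ => z.im = 0 ∧ t₁ < z.re ∧ z.re < t₂)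
          (wilsonDirac (fundamentalRep (Fin 3)) U 0 1).charpoly.roots : ℝ)
        ∂(wilsonMeasure (d := 4) (L := L) (fundamentalRep (Fin 3)) β)
      ≤ C * (1 + β ^ p) * (t₂ - t₁) * (L : ℝ) ^ 4

/-- **First stub of line A**: the route's `WegnerEstimate` (density of states of `Γ₅ D_W(U, m₀, 1)`
near `0`, `m₀ ∈ [−1, 0]`) implies the real-mode landing law, by `CoareaPointwise` + Fatou + Tonelli
(the Wegner bound is exactly `sup_t` of the coarea integrand at `m₀ = −t`). -/
def CoareaTransfer : Prop := WegnerEstimate → RealModeLanding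

/-- **Chirality converse (deterministic).** If on the mass window `[t₀ − η/z, t₀ + η/z]` every
eigenvector of `Γ₅(D_W − t)` with eigenvalue in `(−η − |t − t₀|, η + |t − t₀|)` has chirality
`|⟨φ, Γ₅ φ⟩| ≥ z ‖φ‖²` (speed of the flow bounded BELOW), then the number of eigenvalues of
`Γ₅(D_W − t₀)` in `(−η, η)` is at most the number of real eigenvalues of `D_W` in
`(t₀ − η/z, t₀ + η/z)`: coercivity defects are window sign-defects. -/
def ChiralityConverse : Prop :=
  ∀ (L : ℕ) [NeZero L] (U : GaugeConfig 4 L ↥(Matrix.specialUnitaryGroup (Fin 3) ℂ)) (t₀ η z : ℝ),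
    0 < η → 0 < z → z ≤ 1 →
    (∀ (t : ℝ) (lam : ℝ) (φ : TorusSite 4 L × Fin 3 × Fin 4 → ℂ),
        |t - t₀| ≤ η / z → |lam| < η + |t - t₀| → φ ≠ 0 →
        (spinorLift gammaFive * wilsonDirac (fundamentalRep (Fin 3)) U (-t) 1).mulVec φ = (lam : ℂ) • φ →
        z * (∑ i, ‖φ i‖ ^ 2) ≤ ‖∑ i, star (φ i) * ((spinorLift (L := L) (N := 3) gammaFive).mulVec φ) i‖) →
    Multiset.countP (fun w : ℂ => |w.re| < η)
        (spinorLift gammaFive * wilsonDirac (fundamentalRep (Fin 3)) U (-t₀) 1).charpoly.roots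
      ≤ Multiset.countP (fun w : ℂ => w.im = 0 ∧ t₀ - η / z < w.re ∧ w.re < t₀ + η / z)
        (wilsonDirac (fundamentalRep (Fin 3)) U 0 1).charpoly.roots

/-! ## Card B — the covariant-Laplacian floor of real modes -/

/-- **Positivity identity for real modes** (exact): if `D_W(U,0,1) v = t v` with `t` real then
`2 t ‖v‖² = Σ_μ ‖(1 − W_μ) v‖²`, `W_μ = wilsonHop` the unitary Wilson hopping matrices
(`wilsonDirac_eq_sub_sum_wilsonHop`: `D_W = 4 − Σ_μ W_μ`, so `D_W + D_Wᴴ = Σ_μ (1 − W_μ)ᴴ (1 − W_μ)`). -/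
def RealModePositivity : Prop :=
  ∀ (L : ℕ) [NeZero L] (U : GaugeConfig 4 L ↥(Matrix.specialUnitaryGroup (Fin 3) ℂ)) (t : ℝ)
    (v : TorusSite 4 L × Fin 3 × Fin 4 → ℂ),
    (wilsonDirac (fundamentalRep (Fin 3)) U 0 1).mulVec v = (t : ℂ) • v →
      2 * t * (∑ i, ‖v i‖ ^ 2) =
        ∑ μ : Fin 4, ∑ i, ‖((1 - wilsonHop (fundamentalRep (Fin 3)) U μ).mulVec v) i‖ ^ 2

/-- **Laplacian floor.** Any Rayleigh lower bound `e` for the covariant hop-Laplacian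
`Σ_μ (1 − W_μ)ᴴ(1 − W_μ) = (−Δ_U) ⊗ 1₄` bounds every real eigenvalue of `D_W(U,0,1)` from below by
`e / 2`: sign defects below the Laplacian edge are Lifshitz-tail events of a POSITIVE operator. -/
def LaplacianFloor : Prop :=
  ∀ (L : ℕ) [NeZero L] (U : GaugeConfig 4 L ↥(Matrix.specialUnitaryGroup (Fin 3) ℂ)) (e : ℝ),
    (∀ v : TorusSite 4 L × Fin 3 × Fin 4 → ℂ,
        e * (∑ i, ‖v i‖ ^ 2) ≤
          ∑ μ : Fin 4, ∑ i, ‖((1 - wilsonHop (fundamentalRep (Fin 3)) U μ).mulVec v) i‖ ^ 2) →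
    ∀ z ∈ (wilsonDirac (fundamentalRep (Fin 3)) U 0 1).charpoly.roots, z.im = 0 → e ≤ 2 * z.re

/-- **Laplacian count (min–max form of the floor).** Every unit vector `φ` in the spectral
subspace of `Γ₅(D_W − t)` for `(−η, η)` has `‖(D_W − t)φ‖ < η`, hence covariant Dirichlet energy
`Σ_μ ‖(1 − W_μ)φ‖² = 2 Re⟨φ,(D_W − t)φ⟩ + 2t ≤ 2(t + η)`; by Courant–Fischer the near-zero level
count of the Hermitian Wilson operator is at most `4 ×` the integrated density of states of the
covariant Laplacian `−Δ_U = Σ_μ (2 − F_μ − F_μᴴ)` (site ⊗ colour; the `4` is spin) at energy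
`2(t + η)`: deep coercivity/sign defects are counted by the LOW TAIL OF A POSITIVE BOSONIC OPERATOR. -/
def LaplacianCount : Prop :=
  ∀ (L : ℕ) [NeZero L] (U : GaugeConfig 4 L ↥(Matrix.specialUnitaryGroup (Fin 3) ℂ)) (t η : ℝ),
    0 ≤ η →
    Multiset.countP (fun w : ℂ => |w.re| < η)
        (spinorLift gammaFive * wilsonDirac (fundamentalRep (Fin 3)) U (-t) 1).charpoly.roots
      ≤ 4 * Multiset.countP (fun w : ℂ => w.re ≤ 2 * (t + η))
        (∑ μ : Fin 4, ((2 : ℂ) • (1 : Matrix (TorusSite 4 L × Fin 3) (TorusSite 4 L × Fin 3) ℂ)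
          - linkHop (fundamentalRep (Fin 3)) U μ - (linkHop (fundamentalRep (Fin 3)) U μ).conjTranspose)).charpoly.roots

/-- **Plaquette-deficit bound** (telescoping the holonomy around each plaquette, `4` links per
plaquette, `6` plaquettes per link): a real mode at `t` sees, in the `|v|²`-weighted sense, only
plaquettes within `O(√t)` of the identity: `Σ_x Σ_{i<j} ‖(1 − U_p(x,i,j)) v(x)‖² ≤ 48 t ‖v‖²`. Near the
tip of the Wilson hole (`t → 0⁺`, where the route's line slides) carriers are semiclassical. -/
def PlaquetteDeficitBound : Prop :=
  ∀ (L : ℕ) [NeZero L] (U : GaugeConfig 4 L ↥(Matrix.specialUnitaryGroup (Fin 3) ℂ)) (t : ℝ)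
    (v : TorusSite 4 L × Fin 3 × Fin 4 → ℂ),
    (wilsonDirac (fundamentalRep (Fin 3)) U 0 1).mulVec v = (t : ℂ) • v →
      (∑ x : TorusSite 4 L, ∑ i : Fin 4, ∑ j : Fin 4, if i < j then
          ∑ a : Fin 3, ∑ α : Fin 4,
            ‖v (x, a, α) - ∑ b : Fin 3, (fundamentalRep (Fin 3) (plaquetteHolonomy U x i j)) a b * v (x, b, α)‖ ^ 2
        else 0)
      ≤ 48 * t * ∑ i, ‖v i‖ ^ 2

/-! ## Card C — TIGHT from two moments of the integer index -/

/-- **TIGHT from two moments (Paley–Zygmund / Hölder on the integer-valued index).** For the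
phase-quenched functional `E₊[X] = ∫ X w / ∫ w`, `w = Π_f |det D_W(U, m_f, 1)|`, and the spectral
index `Q = n₋(Γ₅ D_W(U, m₀, 1)) − 6 L⁴`: `E₊|Q| ≥ E₊[Q²]^{3/2} / E₊[Q⁴]^{1/2}`, hence
`(E₊ Q²)³ ≥ E₊ Q⁴` (e.g. `χ_t V ≥ 3` with near-Gaussian `Q`) gives the TIGHT inequality `1 ≤ E₊|Q|`
(non-degeneracy `E₊ Q² > 0` is needed: for `Q ≡ 0` the moment hypothesis holds and TIGHT fails). -/
def TightOfMoments : Prop :=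
  ∀ (Nf L : ℕ) [NeZero L] (β m₀ : ℝ) (mq : Fin Nf → ℝ),
    let μW := wilsonMeasure (d := 4) (L := L) (fundamentalRep (Fin 3)) β
    let w : GaugeConfig 4 L ↥(Matrix.specialUnitaryGroup (Fin 3) ℂ) → ℝ := fun U =>
      ∏ f : Fin Nf, ‖fermionDet (wilsonDirac (fundamentalRep (Fin 3)) U (mq f) 1)‖
    let Q : GaugeConfig 4 L ↥(Matrix.specialUnitaryGroup (Fin 3) ℂ) → ℝ := fun U =>
      (Multiset.countP (fun z : ℂ => z.re < 0)
          (spinorLift gammaFive * wilsonDirac (fundamentalRep (Fin 3)) U m₀ 1).charpoly.roots : ℝ)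
        - 6 * (L : ℝ) ^ 4
    0 < ∫ U, w U ∂μW → 0 < ∫ U, (Q U) ^ 2 * w U ∂μW →
    (∫ U, (Q U) ^ 4 * w U ∂μW) * (∫ U, w U ∂μW) ^ 2 ≤ (∫ U, (Q U) ^ 2 * w U ∂μW) ^ 3 →
      1 ≤ (∫ U, |Q U| * w U ∂μW) / (∫ U, w U ∂μW)

/-! ## Sanity: the three lines end in the crux by name (shape only; the content is in the stubs) -/

/-- Shape check: any proof of `WindowExtinction` closes the crux (the crux is an implication
whose consequent is the hinge). -/
theorem tipPricing_of_windowExtinction (h : WindowExtinction) : TipPricing := fun _ _ => h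

end

end Summit.QuantumFields.QCD.Cruxes.TipPricing.Ideator1
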